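import Summits.MatrixMultiplication.OmegaCensus.SmallFormats.InvertiblePointLineColumnsPlusOne
import HarnessLib

/-!
# ω-census family (a): the MULTI-COLUMN CLAUSE — `p` free columns cost `p` kernel dimensions (given `p + 1` points of `P¹(k)`)

Cell `pub-omega` (unit `pub-omega-tensor`, gen 34), topic `Summits/MatrixMultiplication/OmegaCensus` (sub-folder
`SmallFormats`). Framing (verbatim): lottery ticket; floor = certified bounds/negative ranges. HONEST FRAMING: an elementary
structural lemma over an arbitrary field, generalising the free-column clause (`p = 1`, tensor g24) and the two-column clause
(`p = 2`, the LC+1 law of tensor g27 / `InvertiblePointTwoColumnClause`) to any number `p` of columns, PROVIDED the field has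
`p + 1` pairwise independent vectors in `k²` (i.e. `|P¹(k)| ≥ p + 1`; always for `p ≤ 2`, over `𝔽₃` for `p ≤ 3`, over an infinite
field for every `p`).

**Theorem (`multi_column_clause`).** At a saturated `X₀ = 1` (`|O| = 2n`) let `K₀` be the common kernel of the forms `g_t`,
`t ∉ O`, let `ρ_0, …, ρ_{p-1} ∈ kⁿ` be linearly independent and `E = Σ_l k² ⊗ ρ_l` (dimension `2p`). If `x_0, …, x_p ∈ k²` are
pairwise independent, then `dim (K₀ ⊓ E) ≤ p`.

Proof (dual to LC+1: fix the `x`'s, find the directions). If `dim (K₀ ⊓ E) ≥ p + 1`, each row-plane `{x_i ⊗ w : w ∈ R}`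
(`dim p`) meets it: `x_i ⊗ w_i ∈ K₀` with `0 ≠ w_i ∈ R`. The `p + 1` vectors `w_i ∈ R` are dependent: `Σ a_i w_i = 0`,
`a_{i₀} ≠ 0`. For each off term `s`, the dichotomy (`g_vanish_or_f_vanish`) says `g_s` kills the plane `k² ⊗ w_i` unless `f_s`
kills the annihilator of `x_i`, which happens for at most ONE `i` (`not_f_vanish_two_annihilators`); either way `g_s` kills
`e₀ ⊗ w_{i₀}` (directly, or through the relation). By the frame expansion `e₀ ⊗ w_{i₀} = 0` — absurd. Used by
`InvertiblePointDeltaLawThree`. Not a rank bound by itself; nothing on `ω`.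
-/

namespace Summit.MatrixMultiplication.OmegaCensus.SmallFormats

open Module Matrix Literature.Computability.AlgebraicComplexity

namespace DeltaLaw

variable {k : Type*} [Field k] {n : ℕ} {ι : Type*} [Fintype ι]

/-- `w ↦ x ⊗ w` as a linear map. -/
def vecMulVecRight (x : Fin 2 → k) : (Fin n → k) →ₗ[k] Matrix (Fin 2) (Fin n) k where
  toFun w := vecMulVec x w
  map_add' w w' := by ext i j; simp [vecMulVec_apply, mul_add]
  map_smul' c w := by ext i j; simp [vecMulVec_apply, mul_left_comm]

/-- `vecMulVecRight x w = x ⊗ w`. -/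
@[simp] theorem vecMulVecRight_apply (x : Fin 2 → k) (w : Fin n → k) : vecMulVecRight x w = vecMulVec x w := rfl

/-- `w ↦ x ⊗ w` is injective for `x ≠ 0`. -/
theorem vecMulVecRight_injective {x : Fin 2 → k} (hx : x ≠ 0) : Function.Injective (vecMulVecRight (n := n) x) := by
  intro w w' h
  obtain ⟨a, ha⟩ := Function.ne_iff.mp hx
  funext j
  have := congr_fun (congr_fun h a) j
  simp only [vecMulVecRight_apply, vecMulVec_apply] at this
  exact mul_left_cancel₀ ha this

/-- **The multi-column clause.** See the module docstring. `R = span ρ`, `E ⊇` every `x ⊗ w`, `w ∈ R`, `dim E ≤ 2p`. -/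
theorem multi_column_clause (β : BilinComp (mulBilin k 2 2 n) ι) (O : Finset ι)
    (hO : ∀ i, i ∉ O → β.f i 1 = 0) (hO' : ∀ i ∈ O, β.f i 1 ≠ 0) (hcard : O.card = 2 * n)
    {p : ℕ} (ρ : Fin p → (Fin n → k)) (hρ : LinearIndependent k ρ)
    (xs : Fin (p + 1) → (Fin 2 → k)) (hxs : ∀ i j, i ≠ j → xs i 0 * xs j 1 - xs i 1 * xs j 0 ≠ 0)
    (K₀ : Submodule k (Matrix (Fin 2) (Fin n) k)) (hK₀ : ∀ W ∈ K₀, ∀ t, t ∉ O → β.g t W = 0)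
    (E : Submodule k (Matrix (Fin 2) (Fin n) k)) [FiniteDimensional k E]
    (hE : ∀ (x : Fin 2 → k), ∀ w ∈ Submodule.span k (Set.range ρ), vecMulVec x w ∈ E)
    (hEdim : finrank k E ≤ 2 * p) : finrank k ↥(K₀ ⊓ E) ≤ p := by
  classical
  by_contra hlt
  push Not at hlt
  set R := Submodule.span k (Set.range ρ) with hR
  have hRdim : finrank k R = p := by
    rw [hR, finrank_span_eq_card hρ, Fintype.card_fin]
  -- `p = 0` is trivial
  rcases Nat.eq_zero_or_pos p with hp | hp
  · subst hp
    have := (Submodule.finrank_mono (inf_le_right : K₀ ⊓ E ≤ E)).trans hEdim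
    omega
  -- the `x`'s are nonzero
  haveI : Nontrivial (Fin (p + 1)) := Fin.nontrivial_iff_two_le.mpr (by omega)
  have hx0 : ∀ i, xs i ≠ 0 := by
    intro i h
    obtain ⟨j, hj⟩ := exists_ne i
    exact hxs i j hj.symm (by rw [h]; simp)
  -- (i) each row-plane `x_i ⊗ R` meets `K₀ ⊓ E`
  have hrow : ∀ i, ∃ w ∈ R, w ≠ 0 ∧ vecMulVec (xs i) w ∈ K₀ := by
    intro i
    set P : Submodule k (Matrix (Fin 2) (Fin n) k) := R.map (vecMulVecRight (xs i)) with hP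
    have hPdim : finrank k P = p := by
      rw [hP, ← hRdim]
      exact LinearEquiv.finrank_eq (Submodule.equivMapOfInjective _ (vecMulVecRight_injective (hx0 i)) R).symm
    have hPE : P ≤ E := by
      rintro _ ⟨w, hw, rfl⟩; exact hE _ w hw
    have hKE : K₀ ⊓ E ≤ E := inf_le_right
    -- dimension count inside `E`
    have hsum := Submodule.finrank_sup_add_finrank_inf_eq (K₀ ⊓ E) P
    have hsup : finrank k ↥((K₀ ⊓ E) ⊔ P) ≤ 2 * p := (Submodule.finrank_mono (sup_le hKE hPE)).trans hEdim
    have hpos : 0 < finrank k ↥((K₀ ⊓ E) ⊓ P) := by omega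
    have hne : (K₀ ⊓ E) ⊓ P ≠ ⊥ := fun h => by
      rw [h, finrank_bot] at hpos; exact lt_irrefl 0 hpos
    obtain ⟨W, hWmem, hWne⟩ := Submodule.exists_mem_ne_zero_of_ne_bot hne
    obtain ⟨hWKE, hWP⟩ := Submodule.mem_inf.mp hWmem
    obtain ⟨w, hw, hwW⟩ := Submodule.mem_map.mp hWP
    refine ⟨w, hw, fun h0 => hWne ?_, ?_⟩
    · rw [← hwW, h0, map_zero]
    · rw [← vecMulVecRight_apply, hwW]; exact (Submodule.mem_inf.mp hWKE).1
  choose w hwR hwne hwK using hrow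
  -- (iii) the `p + 1` vectors `w_i ∈ R` are dependent
  have hdep : ¬ LinearIndependent k w := by
    intro hli
    have h1 : finrank k ↥(Submodule.span k (Set.range w)) = p + 1 := by
      rw [finrank_span_eq_card hli, Fintype.card_fin]
    have h2 : Submodule.span k (Set.range w) ≤ R := Submodule.span_le.mpr (by rintro _ ⟨i, rfl⟩; exact hwR i)
    have := Submodule.finrank_mono h2
    omega
  obtain ⟨a, ha, i₀, hai₀⟩ := Fintype.not_linearIndependent_iff.mp hdep
  -- the relation solved for `w i₀`
  have hrel : w i₀ = ∑ j ∈ Finset.univ.erase i₀, (-(a i₀)⁻¹ * a j) • w j := by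
    have h := ha
    rw [← Finset.add_sum_erase _ _ (Finset.mem_univ i₀)] at h
    have : w i₀ = -(a i₀)⁻¹ • ∑ j ∈ Finset.univ.erase i₀, a j • w j := by
      have e : a i₀ • w i₀ = -∑ j ∈ Finset.univ.erase i₀, a j • w j := eq_neg_of_add_eq_zero_left h
      calc w i₀ = (a i₀)⁻¹ • (a i₀ • w i₀) := by rw [smul_smul, inv_mul_cancel₀ hai₀, one_smul]
        _ = _ := by rw [e, smul_neg, neg_smul]
    rw [this, Finset.smul_sum]
    refine Finset.sum_congr rfl fun j _ => ?_
    rw [smul_smul]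
  -- (iv) every off form kills `e₀ ⊗ w i₀`
  have hkill : ∀ s ∈ O, β.g s (vecMulVec (Pi.single 0 1) (w i₀)) = 0 := by
    intro s hs
    rcases g_vanish_or_f_vanish β O hO hO' hcard (hx0 i₀) (fun t ht => hK₀ _ (hwK i₀) t ht) hs with g0 | f0
    · exact g0 _
    · -- `f_s` kills the annihilator of `x i₀`; then `g_s` kills the planes of all `w j`, `j ≠ i₀`
      have hg : ∀ j, j ≠ i₀ → ∀ y : Fin 2 → k, β.g s (vecMulVec y (w j)) = 0 := by
        intro j hj y
        rcases g_vanish_or_f_vanish β O hO hO' hcard (hx0 j) (fun t ht => hK₀ _ (hwK j) t ht) hs with gj | fj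
        · exact gj y
        · exact (not_f_vanish_two_annihilators (β.f s) (hO' s hs) (hxs i₀ j (Ne.symm hj)) f0 fj).elim
      have hsum : vecMulVec (Pi.single 0 1 : Fin 2 → k) (w i₀) =
          ∑ j ∈ Finset.univ.erase i₀, (-(a i₀)⁻¹ * a j) • vecMulVec (Pi.single 0 (1 : k)) (w j) := by
        conv_lhs => rw [hrel]
        rw [← vecMulVecRight_apply, map_sum]
        refine Finset.sum_congr rfl fun j _ => ?_
        rw [map_smul, vecMulVecRight_apply]
      rw [hsum, map_sum]
      refine Finset.sum_eq_zero fun j hj => ?_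
      rw [map_smul, hg j (Finset.ne_of_mem_erase hj), smul_zero]
  -- (v) the frame expansion: `e₀ ⊗ w i₀ = 0`
  have hzero : vecMulVec (Pi.single 0 1 : Fin 2 → k) (w i₀) = 0 := by
    have h := mul_eq_sum_off β 1 O hO (vecMulVec (Pi.single 0 1) (w i₀))
    rw [Matrix.one_mul] at h
    rw [h]
    exact Finset.sum_eq_zero fun s hs => by rw [hkill s hs, mul_zero, zero_smul]
  apply hwne i₀
  funext j
  have := congr_fun (congr_fun hzero 0) j
  rw [vecMulVec_apply, Pi.single_eq_same, one_mul, Matrix.zero_apply] at this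
  exact this

end DeltaLaw

end Summit.MatrixMultiplication.OmegaCensus.SmallFormats
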